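import Literature.Geometry.Kaehler.ComplexTorusIntersectionMixedDiscriminantEquality
import Literature.Geometry.Kaehler.ComplexTorusHodgeIndexSignature
import HarnessLib

/-!
# The mixed Hodge index theorem on `H^{1,1}(X, ℝ)` of a complex torus
# (mixed Hodge–Riemann bilinear relations in bidegree `(1,1)`: Timorin 1998; Dinh–Nguyên 2006, Thm. 1.3)

Layer `Literature/Geometry/Kaehler`, namespace `Literature.Geometry.Kaehler.ComplexTorus`; lane `lit-hodgefound`
(Track 2 foundations library, Layer A: Hodge theory of complex tori on invariant forms), seat p16, generation 18
(row g18-#1, FILE 7). Sequel of `ComplexTorusIntersectionMixedDiscriminantEquality` (the strict negativity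
`torusIntegral_wedgeFamily_self_neg_of_eq_zero` coming from Knuth's kernel theorem for mixed discriminants) and
of `ComplexTorusHodgeIndexSignature` §6 (the UNMIXED Hodge index theorem on `H^{1,1}(X, ℝ)`:
`sigPos_lefschetzRealForm_restrict_realOneOneForms = 1`, `sigNeg … = h^{1,1} - 1`, `𝒞 = (ω, …, ω)`), whose
inertia argument is repeated here word for word with a MIXED positive background `𝒞 = (ω₁, …, ω_{g-2})`.
One bundled-form definition with body (`mixedIntersectionForm`), theorems otherwise; no named fact (net debt 0).

## Sources

* T.-C. Dinh, V.-A. Nguyên, *The mixed Hodge–Riemann bilinear relations for compact Kähler manifolds*, GAFA 16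
  (2006) [DinhNguyen2006] (held `paper:arxiv-math_0501449`), p. 3: for Kähler forms `ω₁, …, ω_{n-p-q+1}`,
  `Q(α, β)` built from `α ∧ β̄ ∧ ω₁ ∧ ⋯ ∧ ω_{n-p-q}` and the mixed primitive space
  `P^{p,q} = {α : α ∧ ω₁ ∧ ⋯ ∧ ω_{n-p-q} ∧ ω_{n-p-q+1} = 0}`: "**Theorem 1.3 (Timorin's Theorem).** If `X` is a
  complex torus of dimension `n`, then `Q(·,·)` is positive definite on `P^{p,q}(X)`"; Prop. 2.1 (b), (c) (p. 5,
  "See Proposition 1, the Main Theorem and Corollary 2 in [Timorin 1998]"): definiteness on `P^{p,q}(ℂⁿ)` and the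
  `Q`-orthogonal splitting `Λ^{p,q} = P^{p,q} ⊕ ω_{n-p-q+1} ∧ Λ^{p-1,q-1}` — for `(p, q) = (1, 1)`:
  `Λ^{1,1}_ℝ = P^{1,1}_ℝ ⊕ ℝ ω_{n-1}`, `Q` definite on each summand with opposite signs.
* V. A. Timorin, *Mixed Hodge–Riemann bilinear relations in a linear context*, Funct. Anal. Appl. 32 (1998)
  268–272 [Timorin1998], Main Theorem and Corollary 2 (constant-coefficient forms on `ℂⁿ` = invariant forms on
  a complex torus).
* D. Huybrechts, *Complex Geometry* (2005) [Huybrechts2005], Cor. 3.3.16 second clause ("Restricted to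
  `H^{1,1}(X)` it is of index `(1, h^{1,1}(X) - 1)`") — the unmixed case, and the index FORMULATION used here.
* R. Schneider, *Convex Bodies* (1993) [Schneider1993], Thm. 6.8.1 (Aleksandrov's inequality for mixed
  discriminants with equality) and D. E. Knuth 1981 [Knuth1981] Thm. 2.3 (non-degeneracy) — the algebra behind
  `torusIntegral_wedgeFamily_self_neg_of_eq_zero`.

## What is proved

`X = E/Φ(ℤ^ι)` of dimension `g ≥ 2` (`e : Fin (2g) ≃ ι`), `η : Fin g → (real 2-forms)` a family of `(1,1)`-forms,
two slots `j₁ ≠ j₂`, the others — the background `𝒞 = (η_j)_{j ≠ j₁, j₂}` — POSITIVE, and `θ = η_{j₂}` positive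
(a Kähler-type class); `H^{1,1}(X, ℝ) = realOneOneForms E` (`dim = g²`).

* §1 `mixedIntersectionForm Φ e η hne : (α, β) ↦ Re ∫_X (-α) ∧ (-β) ∧ ⋀_{j ≠ j₁, j₂} (-η_j)` (the forms put in
  the slots `j₁`, `j₂` of the tree's `wedgeFamily`), a real bilinear form on real `2`-forms; it is the
  intersection number `(L₁ · L₂ · 𝒞)` and is real on `(1,1)`-classes (`coe_mixedIntersectionForm`).
* §2 `mixedIntersectionForm_self_pos_of_pos`: `(M · M · 𝒞) > 0` for `M = -θ`; **mixed Hodge–Riemann in bidegree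
  `(1,1)`** `mixedIntersectionForm_self_neg_of_orthogonal`: `α ∈ H^{1,1}(X, ℝ)`, `α ≠ 0`, `(α · M · 𝒞) = 0` ⇒
  `(α · α · 𝒞) < 0` (Dinh–Nguyên Thm. 1.3 / Timorin for `p = q = 1`, in the intersection-number sign convention).
* §3 **the mixed Hodge index theorem**: restricted to `H^{1,1}(X, ℝ)` the form `(· · · · 𝒞)` has
  `sigPos = 1` (`sigPos_mixedIntersectionForm_restrict_realOneOneForms`) and `sigNeg = g² - 1 = h^{1,1} - 1`
  (`sigNeg_mixedIntersectionForm_restrict_realOneOneForms`), through Mathlib's inertia lemmas exactly as in the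
  unmixed file; Riemann-form corollary `IsRiemannForm.sigPos_sigNeg_mixedIntersectionForm_restrict_realOneOneForms`.
-/

noncomputable section

set_option maxSynthPendingDepth 3

open scoped ComplexOrder ComplexConjugate
open Module Complex Function
open Literature.LinearAlgebra.Matrix

namespace Literature.Geometry.Kaehler

namespace ComplexTorus

variable {ι : Type*} [Fintype ι] [DecidableEq ι] {E : Type*} [NormedAddCommGroup E] [NormedSpace ℂ E]
  (Φ : (ι → ℝ) ≃L[ℝ] E) {g : ℕ}

/-! ## §1 The mixed intersection form `(α, β) ↦ (α · β · 𝒞)` as a real bilinear form -/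

section Form

omit [Fintype ι] [DecidableEq ι] in
/-- The complexified family with the slots `j₁`, `j₂` replaced. [folklore] -/
private theorem family_update₂ (η : Fin g → E [⋀^Fin 2]→L[ℝ] ℝ) {j₁ j₂ : Fin g} (hne : j₁ ≠ j₂)
    (α β : E [⋀^Fin 2]→L[ℝ] ℝ) :
    (fun j ↦ ofRealForm (-(update (update η j₁ α) j₂ β j))) =
      update (update (fun j ↦ ofRealForm (-(η j))) j₂ (ofRealForm (-β))) j₁ (ofRealForm (-α)) := by
  funext j
  by_cases h1 : j = j₁
  · subst h1
    rw [update_self, update_of_ne hne, update_self]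
  · by_cases h2 : j = j₂
    · subst h2
      rw [update_self, update_of_ne h1, update_self]
    · rw [update_of_ne h2, update_of_ne h1, update_of_ne h1, update_of_ne h2]

/-- **The mixed intersection form** `(α, β) ↦ (L_α · L_β · 𝒞) = Re ∫_X (-α) ∧ (-β) ∧ ⋀_{j ≠ j₁, j₂} (-η_j)`
(`α` in slot `j₁`, `β` in slot `j₂` of the tree's `wedgeFamily`; `c₁ = -η` as everywhere in the tree), a real
bilinear form on the real `2`-forms — Dinh–Nguyên's `Q(α, β)` for `(p, q) = (1, 1)` up to their sign
normalisation, Huybrechts' `(α, β) ↦ ∫ α ∧ β ∧ ω^{n-2}` when `𝒞 = (ω, …, ω)`.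
[cite: DinhNguyen2006, §1 Theorem 1.3 and §2 Prop. 2.1 (arXiv PDF pp. 3, 5)] [cite: Huybrechts2005, §1.2 Exercise 1.2.7] -/
def mixedIntersectionForm (e : Fin (2 * g) ≃ ι) (η : Fin g → E [⋀^Fin 2]→L[ℝ] ℝ) {j₁ j₂ : Fin g}
    (hne : j₁ ≠ j₂) : LinearMap.BilinForm ℝ (E [⋀^Fin 2]→L[ℝ] ℝ) :=
  LinearMap.mk₂ ℝ
    (fun α β ↦ (torusIntegral Φ e (wedgeFamily g (fun j ↦ ofRealForm (-(update (update η j₁ α) j₂ β j))))).re)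
    (fun α α' β ↦ by
      simp only [family_update₂ η hne]
      rw [neg_add, ofRealForm_add, wedgeFamily_update_add, torusIntegral_add, Complex.add_re])
    (fun c α β ↦ by
      simp only [family_update₂ η hne]
      rw [← smul_neg, ofRealForm_smul, wedgeFamily_update_smul, torusIntegral_smul, smul_eq_mul,
        Complex.re_ofReal_mul])
    (fun α β β' ↦ by
      simp only [family_update₂ η hne, update_comm hne.symm]
      rw [neg_add, ofRealForm_add, wedgeFamily_update_add, torusIntegral_add, Complex.add_re])
    (fun c α β ↦ by
      simp only [family_update₂ η hne, update_comm hne.symm]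
      rw [← smul_neg, ofRealForm_smul, wedgeFamily_update_smul, torusIntegral_smul, smul_eq_mul,
        Complex.re_ofReal_mul])

omit [Fintype ι] in
/-- `(α · β · 𝒞) = Re ∫_X (-α) ∧ (-β) ∧ ⋀ (-η_j)`. [cite: DinhNguyen2006, §1 Theorem 1.3 (arXiv PDF p. 3)] -/
theorem mixedIntersectionForm_apply (e : Fin (2 * g) ≃ ι) (η : Fin g → E [⋀^Fin 2]→L[ℝ] ℝ) {j₁ j₂ : Fin g}
    (hne : j₁ ≠ j₂) (α β : E [⋀^Fin 2]→L[ℝ] ℝ) :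
    mixedIntersectionForm Φ e η hne α β =
      (torusIntegral Φ e (wedgeFamily g (fun j ↦ ofRealForm (-(update (update η j₁ α) j₂ β j))))).re :=
  rfl

omit [Fintype ι] [DecidableEq ι] in
/-- Replacing two slots of a `(1,1)` family by `(1,1)`-forms keeps it of type `(1,1)`. [folklore] -/
private theorem type_one_one_update₂ {η : Fin g → E [⋀^Fin 2]→L[ℝ] ℝ}
    (h11 : ∀ j (x y : E), η j ![I • x, I • y] = η j ![x, y]) (j₁ j₂ : Fin g) {α β : E [⋀^Fin 2]→L[ℝ] ℝ}
    (hα : ∀ x y : E, α ![I • x, I • y] = α ![x, y]) (hβ : ∀ x y : E, β ![I • x, I • y] = β ![x, y]) :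
    ∀ j (x y : E), update (update η j₁ α) j₂ β j ![I • x, I • y] = update (update η j₁ α) j₂ β j ![x, y] := by
  intro j x y
  by_cases h2 : j = j₂
  · subst h2; rw [update_self]; exact hβ x y
  · rw [update_of_ne h2]
    by_cases h1 : j = j₁
    · subst h1; rw [update_self]; exact hα x y
    · rw [update_of_ne h1]; exact h11 j x y

/-- **`(α · β · 𝒞)` is the (real) intersection number**: for `(1,1)`-forms `α`, `β` and a `(1,1)` family `η`,
`((α · β · 𝒞) : ℂ) = ∫_X (-α) ∧ (-β) ∧ ⋀ (-η_j)`. [cite: Lange2023AbelianVarietiesComplex, §2.2.1 p. 89]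
[cite: DinhNguyen2006, §1 Theorem 1.3 (arXiv PDF p. 3)] -/
theorem coe_mixedIntersectionForm (e : Fin (2 * g) ≃ ι) {η : Fin g → E [⋀^Fin 2]→L[ℝ] ℝ}
    (h11 : ∀ j (x y : E), η j ![I • x, I • y] = η j ![x, y]) {j₁ j₂ : Fin g} (hne : j₁ ≠ j₂)
    {α β : E [⋀^Fin 2]→L[ℝ] ℝ} (hα : α ∈ realOneOneForms E) (hβ : β ∈ realOneOneForms E) :
    (mixedIntersectionForm Φ e η hne α β : ℂ) =
      torusIntegral Φ e (wedgeFamily g (fun j ↦ ofRealForm (-(update (update η j₁ α) j₂ β j)))) := by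
  rw [mixedIntersectionForm_apply]
  exact Complex.ext (by rw [Complex.ofReal_re])
    (by rw [Complex.ofReal_im, torusIntegral_wedgeFamily_im_eq_zero Φ e _ (type_one_one_update₂ h11 j₁ j₂ hα hβ)])

end Form

/-! ## §2 Positivity on the Kähler-type line and mixed Hodge–Riemann on its orthogonal hyperplane -/

section HodgeRiemann

variable {η : Fin g → E [⋀^Fin 2]→L[ℝ] ℝ} {j₁ j₂ : Fin g}

/-- **`(M · M · 𝒞) > 0`** for the positive class `M = -θ`, `θ = η_{j₂}`, against the positive background `𝒞`
(all slots positive: the tree's `torusIntegral_wedgeFamily_pos_of_pos`).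
[cite: Lange2023AbelianVarietiesComplex, §2.2.1 p. 89] [cite: DinhNguyen2006, §2 Prop. 2.1 (c) (arXiv PDF p. 5)] -/
theorem mixedIntersectionForm_self_pos_of_pos (e : Fin (2 * g) ≃ ι)
    (h11 : ∀ j (x y : E), η j ![I • x, I • y] = η j ![x, y]) (hne : j₁ ≠ j₂)
    (hpos : ∀ j, j ≠ j₁ → ∀ v : E, v ≠ 0 → 0 < η j ![I • v, v]) :
    0 < mixedIntersectionForm Φ e η hne (η j₂) (η j₂) := by
  rw [mixedIntersectionForm_apply]
  have hfam : update (update η j₁ (η j₂)) j₂ (η j₂) = update η j₁ (η j₂) :=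
    update_eq_self_iff.2 (by rw [update_of_ne hne.symm])
  rw [hfam]
  have h := torusIntegral_wedgeFamily_pos_of_pos Φ e (update η j₁ (η j₂))
    (fun j x y ↦ by
      by_cases hj : j = j₁
      · subst hj; rw [update_self]; exact h11 j₂ x y
      · rw [update_of_ne hj]; exact h11 j x y)
    (fun j v hv ↦ by
      by_cases hj : j = j₁
      · subst hj; rw [update_self]; exact hpos j₂ hne.symm v hv
      · rw [update_of_ne hj]; exact hpos j hj v hv)
  exact (Complex.lt_def.1 h).1

/-- **Mixed Hodge–Riemann bilinear relation in bidegree `(1,1)` on a complex torus** (Dinh–Nguyên Thm. 1.3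
"Timorin's Theorem: If `X` is a complex torus of dimension `n`, then `Q(·,·)` is positive definite on
`P^{p,q}(X)`", case `p = q = 1`, in the intersection-number sign convention): a real `(1,1)`-class `α ≠ 0` which
is mixed-primitive, `(α · M · 𝒞) = 0`, has `(α · α · 𝒞) < 0`. This is the tree's
`torusIntegral_wedgeFamily_self_neg_of_eq_zero` (Aleksandrov's inequality with Knuth's non-degeneracy) read for
the bilinear form. [cite: DinhNguyen2006, §1 Theorem 1.3 and §2 Prop. 2.1 (b) (arXiv PDF pp. 3, 5)]
[cite: Timorin1998, Main Theorem and Corollary 2] [cite: Schneider1993, §6.8 Theorem 6.8.1] -/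
theorem mixedIntersectionForm_self_neg_of_orthogonal (e : Fin (2 * g) ≃ ι)
    (h11 : ∀ j (x y : E), η j ![I • x, I • y] = η j ![x, y]) (hne : j₁ ≠ j₂)
    (hpos : ∀ j, j ≠ j₁ → ∀ v : E, v ≠ 0 → 0 < η j ![I • v, v])
    {α : E [⋀^Fin 2]→L[ℝ] ℝ} (hα : α ∈ realOneOneForms E)
    (horth : mixedIntersectionForm Φ e η hne α (η j₂) = 0) (hα0 : α ≠ 0) :
    mixedIntersectionForm Φ e η hne α α < 0 := by
  -- the family `η' = (α in slot j₁)`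
  have h11' : ∀ j (x y : E), update η j₁ α j ![I • x, I • y] = update η j₁ α j ![x, y] := fun j x y ↦ by
    by_cases hj : j = j₁
    · subst hj; rw [update_self]; exact hα x y
    · rw [update_of_ne hj]; exact h11 j x y
  have hpos' : ∀ j, j ≠ j₁ → ∀ v : E, v ≠ 0 → 0 < update η j₁ α j ![I • v, v] := fun j hj v hv ↦ by
    rw [update_of_ne hj]; exact hpos j hj v hv
  have hZ : update η j₁ α j₁ ≠ 0 := by rw [update_self]; exact hα0
  -- `(α · M · 𝒞) = 0` as a complex integral
  have h0 : torusIntegral Φ e (wedgeFamily g (fun j ↦ ofRealForm (-(update η j₁ α j)))) = 0 := by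
    have hc := coe_mixedIntersectionForm Φ e h11 hne hα (mem_realOneOneForms_of_I_smul (h11 j₂))
    rw [horth, Complex.ofReal_zero] at hc
    have hfam : update (update η j₁ α) j₂ (η j₂) = update η j₁ α :=
      update_eq_self_iff.2 (by rw [update_of_ne hne.symm])
    rw [hfam] at hc
    exact hc.symm
  have h := torusIntegral_wedgeFamily_self_neg_of_eq_zero Φ e (update η j₁ α) h11' hne hpos' hZ h0
  rw [update_self] at h
  rw [mixedIntersectionForm_apply]
  exact h

end HodgeRiemann

/-! ## §3 The mixed Hodge index theorem: signature `(1, h^{1,1} - 1)` on `H^{1,1}(X, ℝ)` -/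

section Index

variable {η : Fin g → E [⋀^Fin 2]→L[ℝ] ℝ} {j₁ j₂ : Fin g}

/-- **The line `ℝ·M ⊆ H^{1,1}(X, ℝ)` is positive definite for `(· · · · 𝒞)`.**
[cite: DinhNguyen2006, §2 Prop. 2.1 (c) (arXiv PDF p. 5)] [cite: Huybrechts2005, Cor. 3.3.16 (proof)] -/
theorem posDef_mixedIntersectionForm_restrict_span (e : Fin (2 * g) ≃ ι)
    (h11 : ∀ j (x y : E), η j ![I • x, I • y] = η j ![x, y]) (hne : j₁ ≠ j₂)
    (hpos : ∀ j, j ≠ j₁ → ∀ v : E, v ≠ 0 → 0 < η j ![I • v, v]) :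
    ((((mixedIntersectionForm Φ e η hne).toQuadraticMap.restrict (realOneOneForms E))).restrict
      (ℝ ∙ (⟨η j₂, mem_realOneOneForms_of_I_smul (h11 j₂)⟩ : realOneOneForms E))).PosDef := by
  intro x hx
  obtain ⟨t, ht⟩ := Submodule.mem_span_singleton.1 x.2
  have ht0 : t ≠ 0 := by
    rintro rfl
    apply hx
    ext1
    rw [← ht, zero_smul]
    rfl
  rw [QuadraticMap.restrict_apply, QuadraticMap.restrict_apply, LinearMap.BilinMap.toQuadraticMap_apply]
  have hx' : ((x : realOneOneForms E) : E [⋀^Fin 2]→L[ℝ] ℝ) = t • η j₂ := by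
    rw [← ht]; rfl
  rw [hx', map_smul, map_smul, LinearMap.smul_apply, smul_eq_mul, smul_eq_mul, ← mul_assoc]
  exact mul_pos (mul_self_pos.2 ht0) (mixedIntersectionForm_self_pos_of_pos Φ e h11 hne hpos)

include Φ in
/-- `M ≠ 0` in `H^{1,1}(X, ℝ)` (`(M · M · 𝒞) > 0`). [cite: Huybrechts2005, Cor. 3.3.16 (proof)] -/
theorem kaehlerElt_ne_zero (e : Fin (2 * g) ≃ ι)
    (h11 : ∀ j (x y : E), η j ![I • x, I • y] = η j ![x, y]) (hne : j₁ ≠ j₂)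
    (hpos : ∀ j, j ≠ j₁ → ∀ v : E, v ≠ 0 → 0 < η j ![I • v, v]) :
    (⟨η j₂, mem_realOneOneForms_of_I_smul (h11 j₂)⟩ : realOneOneForms E) ≠ 0 := by
  intro h0
  have h := congrArg (fun x : realOneOneForms E ↦ (x : E [⋀^Fin 2]→L[ℝ] ℝ)) h0
  simp only [Submodule.coe_zero] at h
  have hp := mixedIntersectionForm_self_pos_of_pos Φ e h11 hne hpos
  rw [h, LinearMap.map_zero₂] at hp
  exact lt_irrefl _ hp

/-- **The mixed-primitive hyperplane `{α : (α · M · 𝒞) = 0}` has codimension one in `H^{1,1}(X, ℝ)`**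
(Dinh–Nguyên Prop. 2.1 (c): `Λ^{1,1} = P^{1,1} ⊕ ℝ ω_{n-1}`): the functional `(· · M · 𝒞)` is non-zero on
`H^{1,1}(X, ℝ)`. [cite: DinhNguyen2006, §2 Prop. 2.1 (c) (arXiv PDF p. 5)] [cite: Huybrechts2005, §1.2 Example 1.2.37] -/
theorem finrank_ker_mixedIntersectionForm_add_one (e : Fin (2 * g) ≃ ι)
    (h11 : ∀ j (x y : E), η j ![I • x, I • y] = η j ![x, y]) (hne : j₁ ≠ j₂)
    (hpos : ∀ j, j ≠ j₁ → ∀ v : E, v ≠ 0 → 0 < η j ![I • v, v]) :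
    finrank ℝ (LinearMap.ker (((mixedIntersectionForm Φ e η hne).flip (η j₂)).comp (realOneOneForms E).subtype)) + 1 =
      finrank ℝ (realOneOneForms E) := by
  haveI := finiteDimensional_realForms Φ e (k := 2) (by have := j₁.is_lt; omega)
  set ℓ := ((mixedIntersectionForm Φ e η hne).flip (η j₂)).comp (realOneOneForms E).subtype with hℓ
  have hrange : finrank ℝ (LinearMap.range ℓ) = 1 := by
    apply le_antisymm
    · exact (Submodule.finrank_le _).trans (finrank_self ℝ).le
    · rw [Nat.one_le_iff_ne_zero]
      intro h0
      have hbot := Submodule.finrank_eq_zero.1 h0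
      have hmem : ℓ ⟨η j₂, mem_realOneOneForms_of_I_smul (h11 j₂)⟩ ∈ LinearMap.range ℓ :=
        LinearMap.mem_range_self ℓ _
      rw [hbot, Submodule.mem_bot] at hmem
      have hval : ℓ ⟨η j₂, mem_realOneOneForms_of_I_smul (h11 j₂)⟩ =
          mixedIntersectionForm Φ e η hne (η j₂) (η j₂) := rfl
      rw [hval] at hmem
      exact (mixedIntersectionForm_self_pos_of_pos Φ e h11 hne hpos).ne' hmem
  have h := ℓ.finrank_range_add_finrank_ker
  omega

/-- **The mixed Hodge index theorem on `H^{1,1}(X, ℝ)`, positive index: `b⁺ = 1`.** For a complex torus `X`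
of dimension `g ≥ 2`, two slots `j₁ ≠ j₂` and a family `η` of `(1,1)`-forms positive off `j₁`, the mixed
intersection form `(α, β) ↦ (α · β · 𝒞)`, `𝒞 = (η_j)_{j ≠ j₁, j₂}`, restricted to `H^{1,1}(X, ℝ)` has exactly
one positive square: the line `ℝ M` (`M = -η_{j₂}`) is positive and its `(· · M · 𝒞)`-orthogonal hyperplane —
the mixed-primitive classes — is negative definite (mixed Hodge–Riemann, Dinh–Nguyên Thm. 1.3 / Timorin).
Inertia through Mathlib's `le_sigPos_of_posDef` / `sigPos_add_finrank_le_of_nonpos`, as in the unmixed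
`sigPos_lefschetzRealForm_restrict_realOneOneForms`. [cite: DinhNguyen2006, §1 Theorem 1.3 (arXiv PDF p. 3)]
[cite: Timorin1998, Main Theorem and Corollary 2] [cite: Huybrechts2005, Cor. 3.3.16] -/
theorem sigPos_mixedIntersectionForm_restrict_realOneOneForms (e : Fin (2 * g) ≃ ι)
    (h11 : ∀ j (x y : E), η j ![I • x, I • y] = η j ![x, y]) (hne : j₁ ≠ j₂)
    (hpos : ∀ j, j ≠ j₁ → ∀ v : E, v ≠ 0 → 0 < η j ![I • v, v]) :
    sigPos ((mixedIntersectionForm Φ e η hne).toQuadraticMap.restrict (realOneOneForms E)) = 1 := by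
  haveI := finiteDimensional_realForms Φ e (k := 2) (by have := j₁.is_lt; omega)
  set QM := (mixedIntersectionForm Φ e η hne).toQuadraticMap.restrict (realOneOneForms E) with hQM
  set ℓ := ((mixedIntersectionForm Φ e η hne).flip (η j₂)).comp (realOneOneForms E).subtype with hℓ
  have h1 : 1 ≤ sigPos QM := by
    have h := le_sigPos_of_posDef QM (posDef_mixedIntersectionForm_restrict_span Φ e h11 hne hpos)
    rwa [finrank_span_singleton (kaehlerElt_ne_zero Φ e h11 hne hpos)] at h
  have hN : ∀ x ∈ LinearMap.ker ℓ, QM x ≤ 0 := by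
    intro x hx
    rw [hQM, QuadraticMap.restrict_apply, LinearMap.BilinMap.toQuadraticMap_apply]
    rcases eq_or_ne (x : E [⋀^Fin 2]→L[ℝ] ℝ) 0 with h0 | h0
    · rw [h0, LinearMap.map_zero₂]
    · have horth : mixedIntersectionForm Φ e η hne x (η j₂) = 0 := LinearMap.mem_ker.1 hx
      exact (mixedIntersectionForm_self_neg_of_orthogonal Φ e h11 hne hpos x.2 horth h0).le
  have h2 := QuadraticForm.sigPos_add_finrank_le_of_nonpos hN
  have h3 := finrank_ker_mixedIntersectionForm_add_one Φ e h11 hne hpos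
  rw [← hℓ] at h3
  omega

/-- **The mixed Hodge index theorem on `H^{1,1}(X, ℝ)`, negative index: `b⁻ = dim H^{1,1}(X, ℝ) - 1`** (the
mixed-primitive hyperplane is negative definite of the maximal dimension).
[cite: DinhNguyen2006, §1 Theorem 1.3 and §2 Prop. 2.1 (b), (c) (arXiv PDF pp. 3, 5)]
[cite: Timorin1998, Main Theorem and Corollary 2] [cite: Huybrechts2005, Cor. 3.3.16] -/
theorem sigNeg_mixedIntersectionForm_restrict_realOneOneForms (e : Fin (2 * g) ≃ ι)
    (h11 : ∀ j (x y : E), η j ![I • x, I • y] = η j ![x, y]) (hne : j₁ ≠ j₂)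
    (hpos : ∀ j, j ≠ j₁ → ∀ v : E, v ≠ 0 → 0 < η j ![I • v, v]) :
    sigNeg ((mixedIntersectionForm Φ e η hne).toQuadraticMap.restrict (realOneOneForms E)) =
      finrank ℝ (realOneOneForms E) - 1 := by
  haveI := finiteDimensional_realForms Φ e (k := 2) (by have := j₁.is_lt; omega)
  set QM := (mixedIntersectionForm Φ e η hne).toQuadraticMap.restrict (realOneOneForms E) with hQM
  set ℓ := ((mixedIntersectionForm Φ e η hne).flip (η j₂)).comp (realOneOneForms E).subtype with hℓ
  -- the mixed-primitive hyperplane is negative definite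
  have hneg : ((-QM).restrict (LinearMap.ker ℓ)).PosDef := by
    intro x hx
    rw [QuadraticMap.restrict_apply, QuadraticMap.neg_apply, hQM, QuadraticMap.restrict_apply,
      LinearMap.BilinMap.toQuadraticMap_apply]
    have h0 : ((x : realOneOneForms E) : E [⋀^Fin 2]→L[ℝ] ℝ) ≠ 0 := fun h ↦ hx (Subtype.ext (Subtype.ext h))
    have horth : mixedIntersectionForm Φ e η hne (x : realOneOneForms E) (η j₂) = 0 := LinearMap.mem_ker.1 x.2
    exact neg_pos.2 (mixedIntersectionForm_self_neg_of_orthogonal Φ e h11 hne hpos (x : realOneOneForms E).2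
      horth h0)
  have h1 := le_sigNeg_of_negDef QM hneg
  -- the Kähler-type line is non-negative for `-Q`
  have hnn : ∀ x ∈ (ℝ ∙ (⟨η j₂, mem_realOneOneForms_of_I_smul (h11 j₂)⟩ : realOneOneForms E)), (-QM) x ≤ 0 := by
    intro x hx
    rw [QuadraticMap.neg_apply, neg_nonpos]
    rcases eq_or_ne x 0 with rfl | hx0
    · rw [QuadraticMap.map_zero]
    · have h := posDef_mixedIntersectionForm_restrict_span Φ e h11 hne hpos ⟨x, hx⟩
        (fun h ↦ hx0 (congrArg Subtype.val h))
      rw [QuadraticMap.restrict_apply] at h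
      exact h.le
  have h2 := QuadraticForm.sigPos_add_finrank_le_of_nonpos hnn
  rw [sigPos_neg, finrank_span_singleton (kaehlerElt_ne_zero Φ e h11 hne hpos)] at h2
  have h3 := finrank_ker_mixedIntersectionForm_add_one Φ e h11 hne hpos
  rw [← hℓ] at h3
  omega

/-- **The mixed Hodge index theorem on `H^{1,1}(X, ℝ)`, as an index `(1, h^{1,1} - 1) = (1, g² - 1)`** for a
complex torus of dimension `g ≥ 2` and a positive background `𝒞`; for `𝒞 = (ω, …, ω)` this is Huybrechts'
Cor. 3.3.16 second clause (tree: `sigPos_sigNeg_lefschetzRealForm_restrict_realOneOneForms`).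
[cite: DinhNguyen2006, §1 Theorem 1.3 (arXiv PDF p. 3)] [cite: Timorin1998, Main Theorem and Corollary 2]
[cite: Huybrechts2005, Cor. 3.3.16] -/
theorem sigPos_sigNeg_mixedIntersectionForm_restrict_realOneOneForms (e : Fin (2 * g) ≃ ι)
    (h11 : ∀ j (x y : E), η j ![I • x, I • y] = η j ![x, y]) (hne : j₁ ≠ j₂)
    (hpos : ∀ j, j ≠ j₁ → ∀ v : E, v ≠ 0 → 0 < η j ![I • v, v]) :
    sigPos ((mixedIntersectionForm Φ e η hne).toQuadraticMap.restrict (realOneOneForms E)) = 1 ∧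
      sigNeg ((mixedIntersectionForm Φ e η hne).toQuadraticMap.restrict (realOneOneForms E)) = g * g - 1 :=
  ⟨sigPos_mixedIntersectionForm_restrict_realOneOneForms Φ e h11 hne hpos,
    (sigNeg_mixedIntersectionForm_restrict_realOneOneForms Φ e h11 hne hpos).trans
      (by rw [finrank_realOneOneForms Φ e (by have := j₁.is_lt; omega)])⟩

/-- `b⁺ + b⁻ = g² = dim H^{1,1}(X, ℝ)`: the mixed intersection form is NON-DEGENERATE on `H^{1,1}(X, ℝ)`
(Knuth's non-degeneracy of `X ↦ D(X, ·, A₃, …, Aₙ)` on hermitian matrices, read on the torus).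
[cite: Knuth1981, Theorem 2.3] [cite: DinhNguyen2006, §2 Prop. 2.1 (b), (c) (arXiv PDF p. 5)] -/
theorem sigPos_add_sigNeg_mixedIntersectionForm_restrict_realOneOneForms (e : Fin (2 * g) ≃ ι)
    (h11 : ∀ j (x y : E), η j ![I • x, I • y] = η j ![x, y]) (hne : j₁ ≠ j₂)
    (hpos : ∀ j, j ≠ j₁ → ∀ v : E, v ≠ 0 → 0 < η j ![I • v, v]) :
    sigPos ((mixedIntersectionForm Φ e η hne).toQuadraticMap.restrict (realOneOneForms E)) +
      sigNeg ((mixedIntersectionForm Φ e η hne).toQuadraticMap.restrict (realOneOneForms E)) = g * g := by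
  obtain ⟨h1, h2⟩ := sigPos_sigNeg_mixedIntersectionForm_restrict_realOneOneForms Φ e h11 hne hpos
  rw [h1, h2]
  have hg : 2 ≤ g := by
    have h1' := j₁.is_lt; have h2' := j₂.is_lt
    by_contra hlt
    have : g = 1 := by omega
    subst this
    exact hne (Subsingleton.elim _ _)
  have : 1 ≤ g * g := Nat.one_le_iff_ne_zero.2 (by positivity)
  omega

/-- **The mixed Hodge index theorem for Riemann forms** (polarisations `L_j`, `j ≠ j₁`, of an abelian variety
`X` of dimension `g ≥ 2`; `η_{j₁}` any `(1,1)`-form): `(· · · · 𝒞)` on `H^{1,1}(X, ℝ)` has index `(1, g² - 1)`.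
[cite: DinhNguyen2006, §1 Theorem 1.3 (arXiv PDF p. 3)] [cite: Lange2023AbelianVarietiesComplex, §5.1.2 (p. 244)] -/
theorem IsRiemannForm.sigPos_sigNeg_mixedIntersectionForm_restrict_realOneOneForms (e : Fin (2 * g) ≃ ι)
    (h₁ : ∀ x y : E, η j₁ ![I • x, I • y] = η j₁ ![x, y]) (hη : ∀ j, j ≠ j₁ → IsRiemannForm Φ (η j))
    (hne : j₁ ≠ j₂) :
    sigPos ((mixedIntersectionForm Φ e η hne).toQuadraticMap.restrict (realOneOneForms E)) = 1 ∧
      sigNeg ((mixedIntersectionForm Φ e η hne).toQuadraticMap.restrict (realOneOneForms E)) = g * g - 1 :=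
  ComplexTorus.sigPos_sigNeg_mixedIntersectionForm_restrict_realOneOneForms Φ e
    (fun j ↦ by
      by_cases hj : j = j₁
      · subst hj; exact h₁
      · exact (hη j hj).1)
    hne (fun j hj ↦ (hη j hj).2.2)

end Index

end ComplexTorus

end Literature.Geometry.Kaehler

end
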